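import Summits.ResolutionOfSingularities.ResolutionOfSingularities.Theorems.FrobeniusLadderFRationalResolutionToricLogRegular
import Literature.AlgebraicGeometry.Resolution.LogRegularScheme
import HarnessLib

/-!
# Affine toric varieties are log regular schemes (global vocabulary of `LogRegularScheme.lean`)

Support file for crux stmt-ResolutionOfSingularities-15317 (`FrobeniusLadder.FRationalResolution`), line `redirect`,
brick L5. Restates `isLogRegularAt_addMonoidAlgebra` (Kato (2.1) for the tautological chart of `k[P]` at every
prime) in the tree's scheme-level vocabulary: for a field `k` and an fs monoid `P ⊆ ℤⁿ` (finitely generated,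
saturated, spanning), `Spec k[P]` **is a log regular scheme** (`Scheme.IsLogRegular`, one-chart atlas), the form
consumed by the log-geometric lines of the sibling routes (Kato/Nizioł/Illusie–Temkin resolution theorems in
`Literature/AlgebraicGeometry/Resolution/LogRegular*`).

* `isLogRegular_Spec_addMonoidAlgebra` — `Spec k[P]` is log regular.

Folklore (Kato 1994, Ex. (2.2)); no published fact is used as a hypothesis.
-/

-- single-problem summit: the doubled namespace component is forced
set_option linter.dupNamespace false

noncomputable section

namespace Summit.ResolutionOfSingularities.ResolutionOfSingularities.Theorems.FRationalResolution

open AddMonoidAlgebra Literature.AlgebraicGeometry.Resolution AlgebraicGeometry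

universe u

/-- **Affine toric varieties are log regular schemes**: for a field `k` and a finitely generated, saturated
submonoid `P ⊆ ℤⁿ` spanning `ℤⁿ`, the scheme `Spec k[P]` with the one-chart fs Zariski atlas of the tautological
chart `P → k[P]` is logarithmically regular in the sense of Kato (2.1) (tree: `Scheme.IsLogRegular`).
[cite: Kato1994, Def. (2.1), (2.2)] -/
theorem isLogRegular_Spec_addMonoidAlgebra (k : Type u) [Field k] {n : ℕ} (P : AddSubmonoid (Fin n → ℤ))
    (hP : P.FG) (hsat : P.NSMulSaturated) (hspan : Submodule.span ℤ (P : Set (Fin n → ℤ)) = ⊤) :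
    Scheme.IsLogRegular (Spec (.of (AddMonoidAlgebra k ↥P))) := by
  haveI : AddMonoid.FG ↥P := (AddMonoid.fg_iff_addSubmonoid_fg P).2 hP
  haveI : Algebra.FiniteType k (AddMonoidAlgebra k ↥P) := AddMonoidAlgebra.finiteType_of_fg k _
  haveI : IsNoetherianRing (AddMonoidAlgebra k ↥P) := Algebra.FiniteType.isNoetherianRing k _
  exact Scheme.isLogRegular_Spec_of_isLogRegularAt (AddMonoidAlgebra k ↥P) P hP hsat hspan (AddMonoidAlgebra.of k ↥P)
    (fun 𝔭 _ => isLogRegularAt_addMonoidAlgebra k P hP hspan 𝔭)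

end Summit.ResolutionOfSingularities.ResolutionOfSingularities.Theorems.FRationalResolution

end
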